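import Summits.CriticalPhenomena.CardyFormulaZ2.Theses.CardyDualCurrent

/-!
# Assembly of route `CardyDualCurrent` (sub-problem `CardyFormulaZ2`)

Item `stmt-CriticalPhenomena-10758`: the assembly statement
`DualCurrentTemplateR → CanonicalLimitFromExactCR → MartingaleToSLE6 → SLE6ToCardy →
CardyFormulaZ2` of the route `route-CriticalPhenomena-CardyDualCurrent`.  It is pure modus
ponens: `CanonicalLimitFromExactCR` is by definition `(body of DualCurrentTemplateR) →
(body of TemplateCanonicalLimit)`, `MartingaleToSLE6` is `(body of TemplateCanonicalLimit) →
(body of SLE6InterfaceLimit)` and `SLE6ToCardy` is `(body of SLE6InterfaceLimit) →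
CardyFormulaZ2`, so the chain composes definitionally; this is exactly the body of the
route's certified deciding theorem `CardyDualCurrent.closes`.  The negative-side items
`NoDualCurrentRangeOne` / `NoDualCurrentRangeZero`, the intermediate `TemplateCanonicalLimit`
and the shared fact-debt `SLE6CurveExists` are not hypotheses.
-/

namespace Summit.CriticalPhenomena.CardyFormulaZ2.Theorems

open Summit.CriticalPhenomena.CardyFormulaZ2.Theses

/-- **Assembly of the `CardyDualCurrent` route** (item `stmt-CriticalPhenomena-10758`):
the four route hypotheses `DualCurrentTemplateR`, `CanonicalLimitFromExactCR`,
`MartingaleToSLE6`, `SLE6ToCardy` imply `CardyFormulaZ2`, by modus ponens along the chain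
(the same term as the route's deciding theorem `CardyDualCurrent.closes`). -/
theorem cardyDualCurrent_assembly_proof : CardyDualCurrent.Assembly := by
  unfold CardyDualCurrent.Assembly
  intro h2 h4 h5 h9
  exact h9 (h5 (h4 h2))

end Summit.CriticalPhenomena.CardyFormulaZ2.Theorems
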